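import Summits.NavierStokesRegularity.NavierStokesRegularity.Theses.OddMorawetz
import Summits.NavierStokesRegularity.NavierStokesRegularity.Theorems.OddMorawetzOrderThreeIndefiniteDuality
import Summits.NavierStokesRegularity.NavierStokesRegularity.Theorems.OddMorawetzMorawetzKillsTypeIRotate
import Summits.NavierStokesRegularity.NavierStokesRegularity.Theorems.OddMorawetzMorawetzKillsTypeIWeightOneAux
import Literature.Analysis.FluidPDE.IsometryInvariance
import Literature.Analysis.FluidPDE.TaoAveragedEulerContDiff
import HarnessLib

/-!
# Route OddMorawetz — `MorawetzKillsTypeI`: no Morawetz certificate of derivative weight one (the glue)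

(crux item `stmt-NavierStokesRegularity-1377`, line `birth`, registered stub `stub_weightOne_glue`; lands
`--supports` the crux.)

HYPEROCTAHEDRAL AVERAGING. Let `(1, m)` be an admissible density of derivative weight one carrying a Morawetz
certificate: `Q_m ≥ 0` on divergence-free Schwartz fields and `Q_m(v₀) > 0`. For each of the 48 signed
permutation isometries `g` of `ℝ³` (`exists_signedPerm_isometry`) the pushed-forward field `g·v₀` is again
divergence-free Schwartz, so `Q_m(g·v₀) ≥ 0`, and `g = 1` contributes `Q_m(v₀) > 0`; hence `Σ_g Q_m(g·v₀) > 0`.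
On the other hand `Q_m(g·v₀) = Q_{m∘ρ_g}(v₀)` (isometry covariance, `morawetzQ_rotate`, given the covariance of
`B`), each pairing `x ↦ D(m∘ρ_g)(Jv₀ x)[J B(v₀,v₀) x]` is integrable (`integrable_morawetzPairing`: Schwartz decay
of `Jv₀`, the quadratic bound `‖Dm(z)‖ ≤ M‖z‖²` of a cubic form, and `B(v₀,v₀)` with three derivatives in `L²`),
so the sum is `Q_{Σ_g m∘ρ_g}(v₀)`; by the coordinate form of a weight-one density (`τ`) and the finite averaging
identity, `Σ_g m∘ρ_g` is the isotropic-plus-cubic density `N_{α,β,κ}` (`density_signedPerm`), a null Lagrangian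
whose pairing integrates to zero. Contradiction. The four analytic/algebraic ingredients (covariance of `B`,
structure, `div B(v,v) = 0`, averaging identity, null Lagrangian) enter as hypotheses = the registered stubs
`stub_rotate_eulerBilinear`, `stub_weightOne_structure`, `stub_divFree_eulerBilinear`, `stub_weightOne_average`,
`stub_weightOne_nullLagrangian` of the line.
-/

noncomputable section

-- the route's Theorems namespace repeats the summit name by design (Summit.<S>.<P>.Theorems, S = P)
set_option linter.dupNamespace false

namespace Summit.NavierStokesRegularity.NavierStokesRegularity.Theorems

open MeasureTheory


/-! ### The glue -/

/-- **No Morawetz certificate of derivative weight one** (registered stub `stub_weightOne_glue` of the line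
`birth` of crux stmt-NavierStokesRegularity-1377; the five ingredient statements — isometry covariance of `B`,
coordinate form of a weight-one density, `div B(v,v) = 0`, the hyperoctahedral averaging identity, the
null-Lagrangian identity — enter as hypotheses, in this order). See the module docstring for the argument. -/
theorem stub_weightOne_glue :
    (∀ (R : EuclideanSpace ℝ (Fin 3) ≃ₗᵢ[ℝ] EuclideanSpace ℝ (Fin 3)) (v : EuclideanSpace ℝ (Fin 3) → EuclideanSpace ℝ (Fin 3)),
          Literature.Analysis.FluidPDE.eulerBilinear (fun x => R (v (R.symm x))) (fun x => R (v (R.symm x))) =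
            fun x => R (Literature.Analysis.FluidPDE.eulerBilinear v v (R.symm x))) →
    (∀ (k : ℕ) (m : EuclideanSpace ℝ (Fin 3) × (EuclideanSpace ℝ (Fin 3) [×1]→L[ℝ] EuclideanSpace ℝ (Fin 3)) × (EuclideanSpace ℝ (Fin 3) [×2]→L[ℝ] EuclideanSpace ℝ (Fin 3)) × (EuclideanSpace ℝ (Fin 3) [×3]→L[ℝ] EuclideanSpace ℝ (Fin 3)) → ℝ),
          k = 1 → ContDiff ℝ (⊤ : ℕ∞) m → (∀ (μ : ℝ) z, m (μ • z) = μ ^ 3 * m z) →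
          (∀ (s : ℝ), 0 < s → ∀ (z₀ : EuclideanSpace ℝ (Fin 3))
              (z₁ : EuclideanSpace ℝ (Fin 3) [×1]→L[ℝ] EuclideanSpace ℝ (Fin 3))
              (z₂ : EuclideanSpace ℝ (Fin 3) [×2]→L[ℝ] EuclideanSpace ℝ (Fin 3))
              (z₃ : EuclideanSpace ℝ (Fin 3) [×3]→L[ℝ] EuclideanSpace ℝ (Fin 3)),
              m (z₀, s • z₁, (s ^ 2) • z₂, (s ^ 3) • z₃) = s ^ k * m (z₀, z₁, z₂, z₃)) →
          ∃ τ : Fin 3 → Fin 3 → Fin 3 → Fin 3 → ℝ, ∀ (z₀ : EuclideanSpace ℝ (Fin 3))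
              (z₁ : EuclideanSpace ℝ (Fin 3) [×1]→L[ℝ] EuclideanSpace ℝ (Fin 3))
              (z₂ : EuclideanSpace ℝ (Fin 3) [×2]→L[ℝ] EuclideanSpace ℝ (Fin 3))
              (z₃ : EuclideanSpace ℝ (Fin 3) [×3]→L[ℝ] EuclideanSpace ℝ (Fin 3)),
            m (z₀, z₁, z₂, z₃) = ∑ i, ∑ j, ∑ p, ∑ q,
              τ i j p q * z₀ i * z₀ j * z₁ (fun _ => EuclideanSpace.single p (1 : ℝ)) q) →
    (∀ v : EuclideanSpace ℝ (Fin 3) → EuclideanSpace ℝ (Fin 3),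
          Literature.Analysis.FluidPDE.IsSchwartzField v → Literature.Analysis.FluidPDE.VectorCalculus.IsDivFree v →
          Literature.Analysis.FluidPDE.VectorCalculus.IsDivFree (Literature.Analysis.FluidPDE.eulerBilinear v v)) →
    (∀ (τ : Fin 3 → Fin 3 → Fin 3 → Fin 3 → ℝ) (a : Fin 3 → ℝ) (A : Fin 3 → Fin 3 → ℝ),
          (∑ s : Fin 3 → Bool, ∑ π : Equiv.Perm (Fin 3), ∑ i, ∑ j, ∑ p, ∑ q,
              τ (π i) (π j) (π p) (π q) *
                ((if s (π i) then (1 : ℝ) else -1) * (if s (π j) then (1 : ℝ) else -1) *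
                  (if s (π p) then (1 : ℝ) else -1) * (if s (π q) then (1 : ℝ) else -1)) *
                (a i * a j * A p q)) =
            8 * (∑ p, ∑ q, if p = q then 0 else τ p p q q) * ((∑ i, a i ^ 2) * ∑ p, A p p) +
            8 * ((∑ p, ∑ q, if p = q then 0 else τ p q p q) + ∑ p, ∑ q, if p = q then 0 else τ p q q p) *
                (∑ i, ∑ j, a i * a j * A i j) +
            8 * (2 * (∑ p, τ p p p p) - (∑ p, ∑ q, if p = q then 0 else τ p p q q) -
                  (∑ p, ∑ q, if p = q then 0 else τ p q p q) - ∑ p, ∑ q, if p = q then 0 else τ p q q p) *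
                (∑ i, a i ^ 2 * A i i)) →
    (∀ (α β κ : ℝ) (v b : EuclideanSpace ℝ (Fin 3) → EuclideanSpace ℝ (Fin 3)),
          Literature.Analysis.FluidPDE.IsSchwartzField v → Literature.Analysis.FluidPDE.VectorCalculus.IsDivFree v →
          ContDiff ℝ (⊤ : ℕ∞) b → Literature.Analysis.FluidPDE.VectorCalculus.IsDivFree b →
          MeasureTheory.MemLp b 2 MeasureTheory.volume →
          (∀ w : EuclideanSpace ℝ (Fin 3), MeasureTheory.MemLp (fun x => fderiv ℝ b x w) 2 MeasureTheory.volume) →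
          ∫ x, fderiv ℝ (fun z : EuclideanSpace ℝ (Fin 3) × (EuclideanSpace ℝ (Fin 3) [×1]→L[ℝ] EuclideanSpace ℝ (Fin 3)) × (EuclideanSpace ℝ (Fin 3) [×2]→L[ℝ] EuclideanSpace ℝ (Fin 3)) × (EuclideanSpace ℝ (Fin 3) [×3]→L[ℝ] EuclideanSpace ℝ (Fin 3)) =>
                α * (∑ i, z.1 i ^ 2) * (∑ p, z.2.1 (fun _ => EuclideanSpace.single p (1 : ℝ)) p) +
                β * (∑ i, ∑ j, z.1 i * z.1 j * z.2.1 (fun _ => EuclideanSpace.single i (1 : ℝ)) j) +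
                κ * (∑ i, z.1 i ^ 2 * z.2.1 (fun _ => EuclideanSpace.single i (1 : ℝ)) i))
              (v x, iteratedFDeriv ℝ 1 v x, iteratedFDeriv ℝ 2 v x, iteratedFDeriv ℝ 3 v x)
              (b x, iteratedFDeriv ℝ 1 b x, iteratedFDeriv ℝ 2 b x, iteratedFDeriv ℝ 3 b x) = 0) →
    ∀ (k : ℕ) (m : EuclideanSpace ℝ (Fin 3) × (EuclideanSpace ℝ (Fin 3) [×1]→L[ℝ] EuclideanSpace ℝ (Fin 3)) × (EuclideanSpace ℝ (Fin 3) [×2]→L[ℝ] EuclideanSpace ℝ (Fin 3)) × (EuclideanSpace ℝ (Fin 3) [×3]→L[ℝ] EuclideanSpace ℝ (Fin 3)) → ℝ),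
      let J := fun (v : EuclideanSpace ℝ (Fin 3) → EuclideanSpace ℝ (Fin 3)) (x : EuclideanSpace ℝ (Fin 3)) =>
        (v x, iteratedFDeriv ℝ 1 v x, iteratedFDeriv ℝ 2 v x, iteratedFDeriv ℝ 3 v x);
      let Q := fun (v : EuclideanSpace ℝ (Fin 3) → EuclideanSpace ℝ (Fin 3)) =>
        -∫ x, fderiv ℝ m (J v x) (J (Literature.Analysis.FluidPDE.eulerBilinear v v) x);
      k = 1 → ContDiff ℝ (⊤ : ℕ∞) m → (∀ (μ : ℝ) z, m (μ • z) = μ ^ 3 * m z) →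
      (∀ (s : ℝ), 0 < s → ∀ (z₀ : EuclideanSpace ℝ (Fin 3))
          (z₁ : EuclideanSpace ℝ (Fin 3) [×1]→L[ℝ] EuclideanSpace ℝ (Fin 3))
          (z₂ : EuclideanSpace ℝ (Fin 3) [×2]→L[ℝ] EuclideanSpace ℝ (Fin 3))
          (z₃ : EuclideanSpace ℝ (Fin 3) [×3]→L[ℝ] EuclideanSpace ℝ (Fin 3)),
          m (z₀, s • z₁, (s ^ 2) • z₂, (s ^ 3) • z₃) = s ^ k * m (z₀, z₁, z₂, z₃)) →
      (∀ v, Literature.Analysis.FluidPDE.IsSchwartzField v →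
          Literature.Analysis.FluidPDE.VectorCalculus.IsDivFree v → 0 ≤ Q v) →
      (∃ v, Literature.Analysis.FluidPDE.IsSchwartzField v ∧
          Literature.Analysis.FluidPDE.VectorCalculus.IsDivFree v ∧ 0 < Q v) → False := by
  intro hB hT hDB hA hN k m
  dsimp only
  intro hk1 hsm hhom hwt hQ hpos
  subst hk1
  obtain ⟨v₀, hv₀S, hv₀D, hv₀pos⟩ := hpos
  obtain ⟨τ, hτ⟩ := hT 1 m rfl hsm hhom hwt
  -- the 48 signed permutation isometries
  choose Rg hRg using exists_signedPerm_isometry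
  -- abbreviations: the Euler term of `v₀` and the jets
  set b₀ := Literature.Analysis.FluidPDE.eulerBilinear v₀ v₀ with hb₀
  obtain ⟨hb₀s, hb₀2, hDb₀2⟩ := OddMorawetz.eulerBilinear_regularity hv₀S
  -- the pairing functional of a density `m'` on the field `v₀`
  let P : (EuclideanSpace ℝ (Fin 3) × (EuclideanSpace ℝ (Fin 3) [×1]→L[ℝ] EuclideanSpace ℝ (Fin 3)) × (EuclideanSpace ℝ (Fin 3) [×2]→L[ℝ] EuclideanSpace ℝ (Fin 3)) × (EuclideanSpace ℝ (Fin 3) [×3]→L[ℝ] EuclideanSpace ℝ (Fin 3)) → ℝ) → ℝ := fun m' =>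
    ∫ x, fderiv ℝ m' (v₀ x, iteratedFDeriv ℝ 1 v₀ x, iteratedFDeriv ℝ 2 v₀ x, iteratedFDeriv ℝ 3 v₀ x)
      (b₀ x, iteratedFDeriv ℝ 1 b₀ x, iteratedFDeriv ℝ 2 b₀ x, iteratedFDeriv ℝ 3 b₀ x)
  -- the density composed with the jet action of `R`
  let mρ : (EuclideanSpace ℝ (Fin 3) ≃ₗᵢ[ℝ] EuclideanSpace ℝ (Fin 3)) → EuclideanSpace ℝ (Fin 3) × (EuclideanSpace ℝ (Fin 3) [×1]→L[ℝ] EuclideanSpace ℝ (Fin 3)) × (EuclideanSpace ℝ (Fin 3) [×2]→L[ℝ] EuclideanSpace ℝ (Fin 3)) × (EuclideanSpace ℝ (Fin 3) [×3]→L[ℝ] EuclideanSpace ℝ (Fin 3)) → ℝ := fun R z =>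
    m (R z.1,
      (R.toContinuousLinearEquiv : EuclideanSpace ℝ (Fin 3) →L[ℝ] EuclideanSpace ℝ (Fin 3)).compContinuousMultilinearMap
        (z.2.1.compContinuousLinearMap fun _ => (R.symm.toContinuousLinearEquiv : EuclideanSpace ℝ (Fin 3) →L[ℝ] EuclideanSpace ℝ (Fin 3))),
      (R.toContinuousLinearEquiv : EuclideanSpace ℝ (Fin 3) →L[ℝ] EuclideanSpace ℝ (Fin 3)).compContinuousMultilinearMap
        (z.2.2.1.compContinuousLinearMap fun _ => (R.symm.toContinuousLinearEquiv : EuclideanSpace ℝ (Fin 3) →L[ℝ] EuclideanSpace ℝ (Fin 3))),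
      (R.toContinuousLinearEquiv : EuclideanSpace ℝ (Fin 3) →L[ℝ] EuclideanSpace ℝ (Fin 3)).compContinuousMultilinearMap
        (z.2.2.2.compContinuousLinearMap fun _ => (R.symm.toContinuousLinearEquiv : EuclideanSpace ℝ (Fin 3) →L[ℝ] EuclideanSpace ℝ (Fin 3))))
  -- (1) each pushed-forward field is divergence-free Schwartz, so its `Q` is nonnegative, and `Q` is covariant
  have hQR : ∀ R : EuclideanSpace ℝ (Fin 3) ≃ₗᵢ[ℝ] EuclideanSpace ℝ (Fin 3), 0 ≤ -P (mρ R) := by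
    intro R
    have h1 := hQ (fun x => R (v₀ (R.symm x))) (rotate_isSchwartzField R hv₀S)
      (hv₀D.conj_linearIsometryEquiv R)
    have h2 := morawetzQ_rotate hB hsm R v₀
    simp only [] at h1 h2
    rw [h2] at h1
    exact h1
  -- (2) the jet action is linear, so `mρ R` is again a smooth cubic form, and its pairing is integrable
  have hlin : ∀ R : EuclideanSpace ℝ (Fin 3) ≃ₗᵢ[ℝ] EuclideanSpace ℝ (Fin 3), ∃ ρ : (EuclideanSpace ℝ (Fin 3) × (EuclideanSpace ℝ (Fin 3) [×1]→L[ℝ] EuclideanSpace ℝ (Fin 3)) × (EuclideanSpace ℝ (Fin 3) [×2]→L[ℝ] EuclideanSpace ℝ (Fin 3)) × (EuclideanSpace ℝ (Fin 3) [×3]→L[ℝ] EuclideanSpace ℝ (Fin 3))) →L[ℝ] (EuclideanSpace ℝ (Fin 3) × (EuclideanSpace ℝ (Fin 3) [×1]→L[ℝ] EuclideanSpace ℝ (Fin 3)) × (EuclideanSpace ℝ (Fin 3) [×2]→L[ℝ] EuclideanSpace ℝ (Fin 3)) × (EuclideanSpace ℝ (Fin 3) [×3]→L[ℝ] EuclideanSpace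 ℝ (Fin 3))), mρ R = m ∘ ρ := by
    intro R
    let Rc : EuclideanSpace ℝ (Fin 3) →L[ℝ] EuclideanSpace ℝ (Fin 3) := (R.toContinuousLinearEquiv : EuclideanSpace ℝ (Fin 3) →L[ℝ] EuclideanSpace ℝ (Fin 3))
    let Sc : EuclideanSpace ℝ (Fin 3) →L[ℝ] EuclideanSpace ℝ (Fin 3) := (R.symm.toContinuousLinearEquiv : EuclideanSpace ℝ (Fin 3) →L[ℝ] EuclideanSpace ℝ (Fin 3))
    let ρ₁ : (EuclideanSpace ℝ (Fin 3) [×1]→L[ℝ] EuclideanSpace ℝ (Fin 3)) →L[ℝ] (EuclideanSpace ℝ (Fin 3) [×1]→L[ℝ] EuclideanSpace ℝ (Fin 3)) :=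
      (ContinuousLinearMap.compContinuousMultilinearMapL ℝ (fun _ : Fin 1 => EuclideanSpace ℝ (Fin 3)) (EuclideanSpace ℝ (Fin 3)) (EuclideanSpace ℝ (Fin 3)) Rc).comp
        (ContinuousMultilinearMap.compContinuousLinearMapL fun _ : Fin 1 => Sc)
    let ρ₂ : (EuclideanSpace ℝ (Fin 3) [×2]→L[ℝ] EuclideanSpace ℝ (Fin 3)) →L[ℝ] (EuclideanSpace ℝ (Fin 3) [×2]→L[ℝ] EuclideanSpace ℝ (Fin 3)) :=
      (ContinuousLinearMap.compContinuousMultilinearMapL ℝ (fun _ : Fin 2 => EuclideanSpace ℝ (Fin 3)) (EuclideanSpace ℝ (Fin 3)) (EuclideanSpace ℝ (Fin 3)) Rc).comp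
        (ContinuousMultilinearMap.compContinuousLinearMapL fun _ : Fin 2 => Sc)
    let ρ₃ : (EuclideanSpace ℝ (Fin 3) [×3]→L[ℝ] EuclideanSpace ℝ (Fin 3)) →L[ℝ] (EuclideanSpace ℝ (Fin 3) [×3]→L[ℝ] EuclideanSpace ℝ (Fin 3)) :=
      (ContinuousLinearMap.compContinuousMultilinearMapL ℝ (fun _ : Fin 3 => EuclideanSpace ℝ (Fin 3)) (EuclideanSpace ℝ (Fin 3)) (EuclideanSpace ℝ (Fin 3)) Rc).comp
        (ContinuousMultilinearMap.compContinuousLinearMapL fun _ : Fin 3 => Sc)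
    refine ⟨Rc.prodMap (ρ₁.prodMap (ρ₂.prodMap ρ₃)), ?_⟩
    funext z
    obtain ⟨a₀, a₁, a₂, a₃⟩ := z
    rfl
  have hsmR : ∀ R : EuclideanSpace ℝ (Fin 3) ≃ₗᵢ[ℝ] EuclideanSpace ℝ (Fin 3), ContDiff ℝ (⊤ : ℕ∞) (mρ R) := by
    intro R
    obtain ⟨ρ, hρ⟩ := hlin R
    rw [hρ]
    exact hsm.comp ρ.contDiff
  have hhomR : ∀ (R : EuclideanSpace ℝ (Fin 3) ≃ₗᵢ[ℝ] EuclideanSpace ℝ (Fin 3)) (μ : ℝ) (z : EuclideanSpace ℝ (Fin 3) × (EuclideanSpace ℝ (Fin 3) [×1]→L[ℝ] EuclideanSpace ℝ (Fin 3)) × (EuclideanSpace ℝ (Fin 3) [×2]→L[ℝ] EuclideanSpace ℝ (Fin 3)) × (EuclideanSpace ℝ (Fin 3) [×3]→L[ℝ] EuclideanSpace ℝ (Fin 3))), mρ R (μ • z) = μ ^ 3 * mρ R z := by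
    intro R μ z
    obtain ⟨ρ, hρ⟩ := hlin R
    rw [hρ, Function.comp_apply, Function.comp_apply, map_smul, hhom]
  have hint : ∀ R : EuclideanSpace ℝ (Fin 3) ≃ₗᵢ[ℝ] EuclideanSpace ℝ (Fin 3), Integrable (fun x =>
      fderiv ℝ (mρ R) (v₀ x, iteratedFDeriv ℝ 1 v₀ x, iteratedFDeriv ℝ 2 v₀ x, iteratedFDeriv ℝ 3 v₀ x)
        (b₀ x, iteratedFDeriv ℝ 1 b₀ x, iteratedFDeriv ℝ 2 b₀ x, iteratedFDeriv ℝ 3 b₀ x)) :=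
    fun R => integrable_morawetzPairing (hsmR R) (hhomR R) hv₀S
  -- (3) the identity isometry contributes `Q(v₀) > 0`, so the hyperoctahedral sum is positive
  set s₁ : Fin 3 → Bool := fun _ => true with hs₁
  have hid : ∀ x : EuclideanSpace ℝ (Fin 3), Rg s₁ 1 x = x := by
    intro x
    ext i
    rw [hRg]
    simp only [hs₁, if_true, one_mul]
    rfl
  have hid' : ∀ x : EuclideanSpace ℝ (Fin 3), (Rg s₁ 1).symm x = x := fun x =>
    (Rg s₁ 1).injective (by rw [LinearIsometryEquiv.apply_symm_apply, hid])
  have hfun : (fun x => Rg s₁ 1 (v₀ ((Rg s₁ 1).symm x))) = v₀ := by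
    funext x
    rw [hid', hid]
  have hpos₁ : 0 < -P (mρ (Rg s₁ 1)) := by
    have h2 := morawetzQ_rotate hB hsm (Rg s₁ 1) v₀
    rw [hfun] at h2
    rw [h2] at hv₀pos
    exact hv₀pos
  have hsum_pos : 0 < ∑ s : Fin 3 → Bool, ∑ π : Equiv.Perm (Fin 3), -P (mρ (Rg s π)) := by
    have h1 : -P (mρ (Rg s₁ 1)) ≤ ∑ π : Equiv.Perm (Fin 3), -P (mρ (Rg s₁ π)) :=
      Finset.single_le_sum (f := fun π => -P (mρ (Rg s₁ π))) (fun π _ => hQR _) (Finset.mem_univ _)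
    have h2 : ∑ π : Equiv.Perm (Fin 3), -P (mρ (Rg s₁ π)) ≤
        ∑ s : Fin 3 → Bool, ∑ π : Equiv.Perm (Fin 3), -P (mρ (Rg s π)) :=
      Finset.single_le_sum (f := fun s => ∑ π : Equiv.Perm (Fin 3), -P (mρ (Rg s π)))
        (fun s _ => Finset.sum_nonneg fun π _ => hQR _) (Finset.mem_univ _)
    linarith
  -- (4) the hyperoctahedral sum of the pairings is the pairing of the summed density, a null Lagrangian
  set α : ℝ := 8 * ∑ p, ∑ q, if p = q then 0 else τ p p q q with hα
  set β : ℝ := 8 * ((∑ p, ∑ q, if p = q then 0 else τ p q p q) + ∑ p, ∑ q, if p = q then 0 else τ p q q p) with hβ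
  set κ : ℝ := 8 * (2 * (∑ p, τ p p p p) - (∑ p, ∑ q, if p = q then 0 else τ p p q q) -
      (∑ p, ∑ q, if p = q then 0 else τ p q p q) - ∑ p, ∑ q, if p = q then 0 else τ p q q p) with hκ
  let N : EuclideanSpace ℝ (Fin 3) × (EuclideanSpace ℝ (Fin 3) [×1]→L[ℝ] EuclideanSpace ℝ (Fin 3)) × (EuclideanSpace ℝ (Fin 3) [×2]→L[ℝ] EuclideanSpace ℝ (Fin 3)) × (EuclideanSpace ℝ (Fin 3) [×3]→L[ℝ] EuclideanSpace ℝ (Fin 3)) → ℝ := fun z =>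
    α * (∑ i, z.1 i ^ 2) * (∑ p, z.2.1 (fun _ => EuclideanSpace.single p (1 : ℝ)) p) +
    β * (∑ i, ∑ j, z.1 i * z.1 j * z.2.1 (fun _ => EuclideanSpace.single i (1 : ℝ)) j) +
    κ * (∑ i, z.1 i ^ 2 * z.2.1 (fun _ => EuclideanSpace.single i (1 : ℝ)) i)
  have hNsum : (fun z => ∑ s : Fin 3 → Bool, ∑ π : Equiv.Perm (Fin 3), mρ (Rg s π) z) = N := by
    funext z
    have hkey : ∀ (s : Fin 3 → Bool) (π : Equiv.Perm (Fin 3)), mρ (Rg s π) z =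
        ∑ i, ∑ j, ∑ p, ∑ q,
          τ (π i) (π j) (π p) (π q) *
            ((if s (π i) then (1 : ℝ) else -1) * (if s (π j) then (1 : ℝ) else -1) *
              (if s (π p) then (1 : ℝ) else -1) * (if s (π q) then (1 : ℝ) else -1)) *
            (z.1 i * z.1 j * z.2.1 (fun _ => EuclideanSpace.single p (1 : ℝ)) q) :=
      fun s π => density_signedPerm hτ (hRg s π) z
    simp only [hkey]
    rw [hA τ (fun i => z.1 i) (fun p q => z.2.1 (fun _ => EuclideanSpace.single p (1 : ℝ)) q)]
    simp only [N, hα, hβ, hκ]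
    ring
  have hdiff : ∀ (R : EuclideanSpace ℝ (Fin 3) ≃ₗᵢ[ℝ] EuclideanSpace ℝ (Fin 3)) (z : EuclideanSpace ℝ (Fin 3) × (EuclideanSpace ℝ (Fin 3) [×1]→L[ℝ] EuclideanSpace ℝ (Fin 3)) × (EuclideanSpace ℝ (Fin 3) [×2]→L[ℝ] EuclideanSpace ℝ (Fin 3)) × (EuclideanSpace ℝ (Fin 3) [×3]→L[ℝ] EuclideanSpace ℝ (Fin 3))), DifferentiableAt ℝ (mρ R) z :=
    fun R z => ((hsmR R).differentiable (by simp)).differentiableAt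
  have hptw : ∀ x : EuclideanSpace ℝ (Fin 3),
      ∑ s : Fin 3 → Bool, ∑ π : Equiv.Perm (Fin 3),
        fderiv ℝ (mρ (Rg s π)) (v₀ x, iteratedFDeriv ℝ 1 v₀ x, iteratedFDeriv ℝ 2 v₀ x, iteratedFDeriv ℝ 3 v₀ x)
          (b₀ x, iteratedFDeriv ℝ 1 b₀ x, iteratedFDeriv ℝ 2 b₀ x, iteratedFDeriv ℝ 3 b₀ x) =
      fderiv ℝ N (v₀ x, iteratedFDeriv ℝ 1 v₀ x, iteratedFDeriv ℝ 2 v₀ x, iteratedFDeriv ℝ 3 v₀ x)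
          (b₀ x, iteratedFDeriv ℝ 1 b₀ x, iteratedFDeriv ℝ 2 b₀ x, iteratedFDeriv ℝ 3 b₀ x) := by
    intro x
    rw [← hNsum]
    rw [fderiv_fun_sum (fun s _ => DifferentiableAt.fun_sum fun π _ => hdiff _ _),
      FunLike.coe_sum, Finset.sum_apply]
    refine Finset.sum_congr rfl fun s _ => ?_
    rw [fderiv_fun_sum (fun π _ => hdiff _ _), FunLike.coe_sum, Finset.sum_apply]
  have hsumP : ∑ s : Fin 3 → Bool, ∑ π : Equiv.Perm (Fin 3), P (mρ (Rg s π)) = 0 := by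
    have h1 : ∀ s : Fin 3 → Bool, ∑ π : Equiv.Perm (Fin 3), P (mρ (Rg s π)) =
        ∫ x, ∑ π : Equiv.Perm (Fin 3),
          fderiv ℝ (mρ (Rg s π)) (v₀ x, iteratedFDeriv ℝ 1 v₀ x, iteratedFDeriv ℝ 2 v₀ x, iteratedFDeriv ℝ 3 v₀ x)
            (b₀ x, iteratedFDeriv ℝ 1 b₀ x, iteratedFDeriv ℝ 2 b₀ x, iteratedFDeriv ℝ 3 b₀ x) :=
      fun s => (integral_finsetSum _ fun π _ => hint (Rg s π)).symm
    simp only [h1]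
    rw [← integral_finsetSum _ fun s _ => integrable_finsetSum _ fun π _ => hint (Rg s π)]
    simp only [hptw]
    exact hN α β κ v₀ b₀ hv₀S hv₀D hb₀s (hDB v₀ hv₀S hv₀D) hb₀2 hDb₀2
  -- (5) contradiction
  have hneg : ∑ s : Fin 3 → Bool, ∑ π : Equiv.Perm (Fin 3), -P (mρ (Rg s π)) = 0 := by
    simp only [Finset.sum_neg_distrib, hsumP, neg_zero]
  linarith

end Summit.NavierStokesRegularity.NavierStokesRegularity.Theorems

end
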